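import Mathlib
import Literature.Computability.AlgebraicComplexity.AsymptoticSpectrum
import Literature.Computability.AlgebraicComplexity.AsymptoticSpectrumProofs
import Literature.Computability.AlgebraicComplexity.MatrixMultiplicationExponent
import Literature.Computability.AlgebraicComplexity.FlatteningRank
import Literature.Computability.AlgebraicComplexity.FlatteningBound
import Literature.Computability.AlgebraicComplexity.TensorRestrictionRank
import Literature.Computability.AlgebraicComplexity.CoppersmithWinograd1990Proofs
import Literature.Computability.AlgebraicComplexity.DegenerationSpectralMonotone
import Literature.Barriers.MatrixMultiplication.RectangularBarrier

/-!
# OutsiderSandwich — degeneration witnesses, PART 1 of 3 (route-free helper)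

LANDING SPLIT (decomp-mm-lander-1 g1, 2026-08-30; mechanical, for the 400-line lint) of the lens-4 gen-7 landing form
`OutsiderSandwichDegenerationWitness.lean` (sha256 `b3aed0e0…4934`, 767 lines; critic-CLEARED decomp-mm STATUS l.342,
rc0 · 0 sorry · std axioms; REQUESTS #14).  This part = source sections «Restriction plumbing», «Degenerations: padding, products, powers» (source lines 54–287), copied
byte-identically EXCEPT one gate-forced dedup edit: the folklore lemma `kronecker_matMul_restrictsTo` (≡ the landed `Theorems.OutsiderSandwichPackingProfile.matMul_kronecker_matMul_restrictsTo`, dedup.landed) is deleted and re-created as a local `have` (same statement, same proof) inside its user(s).  It imports NO `Theses` file (lint `theses-cone`).  PART 2 = `…DegenerationWitnessRate.lean` (analysis + rate), PART 3 = `…DegenerationWitness.lean` (TOP/BOTTOM/germ equivalences and the asides 30534–30538 BY NAME, importing `Theses.OutsiderSandwich`; it carries the full module docstring of the source).  Parts 1–2 SUPPORT item `stmt-MatrixMultiplication-30534`; nothing here proves ω = 2.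
-/

set_option linter.dupNamespace false

namespace Summit.MatrixMultiplication.MatrixMultiplication.Theorems.OutsiderSandwichDegenerationWitness

open Polynomial
open Literature.Computability.AlgebraicComplexity

/-! ## Restriction plumbing around `cw₂^{⊠N}` and `⟨m,m,m⟩` (relabellings and zeroings) -/

section Restrictions

/-- `cw₂^{⊠(N+N')} ≥ cw₂^{⊠N} ⊗ cw₂^{⊠N'}` (relabelling `Fin (N+N') ≃ Fin N ⊕ Fin N'`,
tree `kroneckerPow_add_eq_precomp`). [cite: ConnerGesmundoLandsbergVentura2022, §1 (p. 3)] -/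
theorem cwPow_add_restrictsTo (N N' : ℕ) :
    TensorRestrictsTo (kroneckerPow (cwTensor ℂ 2) (N + N'))
      (kroneckerTensor (kroneckerPow (cwTensor ℂ 2) N) (kroneckerPow (cwTensor ℂ 2) N')) := by
  classical
  have e : kroneckerTensor (kroneckerPow (cwTensor ℂ 2) N) (kroneckerPow (cwTensor ℂ 2) N') =
      fun a b c => kroneckerPow (cwTensor ℂ 2) (N + N') (Fin.append a.1 a.2) (Fin.append b.1 b.2)
        (Fin.append c.1 c.2) := by
    rw [kroneckerPow_add_eq_precomp (cwTensor ℂ 2) N N']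
    funext a b c
    simp only [Fin.append_left, Fin.append_right]
  rw [e]
  exact tensorRestrictsTo_precomp _ _ _ _

/-- **Product of finite witnesses**: `⟨m,m,m⟩ ≤ cw₂^{⊠N}` and `⟨m',m',m'⟩ ≤ cw₂^{⊠N'}` give
`⟨mm',mm',mm'⟩ ≤ cw₂^{⊠(N+N')}`. [folklore] -/
theorem mm_mul {N N' m m' : ℕ}
    (h : TensorRestrictsTo (kroneckerPow (cwTensor ℂ 2) N) (matMulTensor ℂ m m m))
    (h' : TensorRestrictsTo (kroneckerPow (cwTensor ℂ 2) N') (matMulTensor ℂ m' m' m')) :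
    TensorRestrictsTo (kroneckerPow (cwTensor ℂ 2) (N + N')) (matMulTensor ℂ (m * m') (m * m') (m * m')) := by
  -- `⟨m,m,m⟩ ⊗ ⟨m',m',m'⟩ ≥ ⟨mm',mm',mm'⟩` (double-index relabelling) [cite: Blaser2013, §5.2 p. 24] — a local copy:
  -- the identical lemma is LANDED as `Theorems.OutsiderSandwichPackingProfile.matMul_kronecker_matMul_restrictsTo`
  -- (gate dedup.landed), whose module imports the route file and is therefore not imported into this route-free helper.
  have kronecker_matMul_restrictsTo : ∀ m m' : ℕ,
      TensorRestrictsTo (kroneckerTensor (matMulTensor ℂ m m m) (matMulTensor ℂ m' m' m'))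
        (matMulTensor ℂ (m * m') (m * m') (m * m')) := by
    intro m m'
    have e : kroneckerTensor (matMulTensor ℂ m m m) (matMulTensor ℂ m' m' m') = fun a b c =>
        matMulTensor ℂ (m * m') (m * m') (m * m') (doubleIndexEquiv m m m' m' a)
          (doubleIndexEquiv m m m' m' b) (doubleIndexEquiv m m m' m' c) := by
      funext a b c
      exact kroneckerTensor_matMulTensor (K := ℂ) m m m m' m' m' a b c
    rw [e]
    exact tensorRestrictsTo_of_reindex (matMulTensor ℂ _ _ _) _ _ _
  exact ((cwPow_add_restrictsTo N N').trans (h.kronecker h')).trans (kronecker_matMul_restrictsTo m m')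

/-- Powers of one finite witness: `I(N,m) ⟹ I(N(k+1), m^{k+1})`. [folklore] -/
theorem mm_pow {N m : ℕ}
    (h : TensorRestrictsTo (kroneckerPow (cwTensor ℂ 2) N) (matMulTensor ℂ m m m)) (k : ℕ) :
    TensorRestrictsTo (kroneckerPow (cwTensor ℂ 2) (N * (k + 1)))
      (matMulTensor ℂ (m ^ (k + 1)) (m ^ (k + 1)) (m ^ (k + 1))) := by
  induction k with
  | zero =>
      rw [Nat.zero_add, Nat.mul_one, pow_one]
      exact h
  | succ k ih =>
      have e1 : N * (k + 1 + 1) = N * (k + 1) + N := by ring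
      rw [e1, pow_succ]
      exact mm_mul ih h

/-- `⟨2⟩ = cw₂ ∘ (x ↦ ![0,2], y ↦ ![1,2], z ↦ ![1,0])` over `ℤ` — the zeroing `⟨2⟩ ≤ cw₂`
(keep `x₀y₁z₁`, `x₂y₂z₀`; kill `x₁, y₀, z₂`), by `decide`. [folklore] -/
theorem unitTwo_int_identity : ∀ i j k : Fin 2,
    unitTensor ℤ 2 i j k =
      cwTensor ℤ 2 ((![0, 2] : Fin 2 → Fin 3) i) ((![1, 2] : Fin 2 → Fin 3) j)
        ((![1, 0] : Fin 2 → Fin 3) k) := by decide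

/-- cast `ℤ → ℂ` of the `0/1` tensor `cw_q`. [folklore] -/
theorem intCast_cwTensor (q : ℕ) (i j k : Fin (q + 1)) :
    ((cwTensor ℤ q i j k : ℤ) : ℂ) = cwTensor ℂ q i j k := by
  simp only [cwTensor_apply]; split_ifs <;> simp

/-- cast `ℤ → ℂ` of the unit tensor. [folklore] -/
theorem intCast_unitTensor (n : ℕ) (i j k : Fin n) :
    ((unitTensor ℤ n i j k : ℤ) : ℂ) = unitTensor ℂ n i j k := by
  simp only [unitTensor_apply]; split_ifs <;> simp

/-- `Q(cw₂) ≥ 2`: **`⟨2⟩ ≤ cw₂`** by zeroing. [cite: CoppersmithWinograd1990, §11] -/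
theorem cwTwo_restrictsTo_unitTwo : TensorRestrictsTo (cwTensor ℂ 2) (unitTensor ℂ 2) := by
  have e : unitTensor ℂ 2 = fun i j k =>
      cwTensor ℂ 2 ((![0, 2] : Fin 2 → Fin 3) i) ((![1, 2] : Fin 2 → Fin 3) j)
        ((![1, 0] : Fin 2 → Fin 3) k) := by
    funext i j k
    rw [← intCast_unitTensor, ← intCast_cwTensor, unitTwo_int_identity]
  rw [e]
  exact tensorRestrictsTo_precomp _ _ _ _

/-- `t^{⊠1} ≥ t` (constant index maps). [folklore] -/
theorem kroneckerPow_one_restrictsTo {ι κ μ : Type} [Fintype ι] [Fintype κ] [Fintype μ]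
    [DecidableEq ι] [DecidableEq κ] [DecidableEq μ] (t : ι → κ → μ → ℂ) :
    TensorRestrictsTo (kroneckerPow t 1) t := by
  have h := tensorRestrictsTo_precomp (kroneckerPow t 1) (fun (a : ι) (_ : Fin 1) => a)
    (fun (b : κ) (_ : Fin 1) => b) (fun (c : μ) (_ : Fin 1) => c)
  simpa [kroneckerPow_apply] using h

/-- `⟨F⟩ ⊗ ⟨r⟩ ≥ ⟨F·r⟩` (relabelling by `finProdFinEquiv`). [folklore] -/
theorem kronecker_unitTensor_restrictsTo (F r : ℕ) :
    TensorRestrictsTo (kroneckerTensor (unitTensor ℂ F) (unitTensor ℂ r)) (unitTensor ℂ (F * r)) := by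
  have key : ∀ x y z : Fin F × Fin r, unitTensor ℂ (F * r) (finProdFinEquiv x) (finProdFinEquiv y)
      (finProdFinEquiv z) = kroneckerTensor (unitTensor ℂ F) (unitTensor ℂ r) x y z := by
    rintro ⟨x1, x2⟩ ⟨y1, y2⟩ ⟨z1, z2⟩
    simp only [kroneckerTensor_apply, unitTensor_apply, EmbeddingLike.apply_eq_iff_eq, Prod.mk.injEq]
    split_ifs <;> simp_all
  have e : unitTensor ℂ (F * r) = fun a b c =>
      kroneckerTensor (unitTensor ℂ F) (unitTensor ℂ r) (finProdFinEquiv.symm a)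
        (finProdFinEquiv.symm b) (finProdFinEquiv.symm c) := by
    funext a b c
    rw [← key, Equiv.apply_symm_apply, Equiv.apply_symm_apply, Equiv.apply_symm_apply]
  rw [e]
  exact tensorRestrictsTo_precomp _ _ _ _

/-- **`⟨2^L⟩ ≤ cw₂^{⊠L}`**: a diagonal of size `2^L` inside `L` copies of `cw₂`, by zeroing
(`Q(cw₂^{⊠L}) ≥ Q(cw₂)^L = 2^L`). [cite: CoppersmithWinograd1990, §11] -/
theorem cwPow_restrictsTo_unitTensor (L : ℕ) :
    TensorRestrictsTo (kroneckerPow (cwTensor ℂ 2) L) (unitTensor ℂ (2 ^ L)) := by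
  induction L with
  | zero =>
      rw [pow_zero]
      have e : unitTensor ℂ 1 = fun _ _ _ =>
          kroneckerPow (cwTensor ℂ 2) 0 (fun x => x.elim0) (fun x => x.elim0) (fun x => x.elim0) := by
        funext i j k
        rw [kroneckerPow_zero, unitTensor_one]
      rw [e]
      exact tensorRestrictsTo_precomp _ _ _ _
  | succ L ih =>
      rw [pow_succ]
      exact ((cwPow_add_restrictsTo L 1).trans
        (ih.kronecker
          ((kroneckerPow_one_restrictsTo _).trans cwTwo_restrictsTo_unitTwo))).trans
        (kronecker_unitTensor_restrictsTo (2 ^ L) 2)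

/-- `ζ⁽¹⁾(t) ≤ |ι|`. [folklore] -/
theorem flatteningRank_le_card' {ι κ μ : Type*} [Fintype ι] (t : ι → κ → μ → ℂ) :
    flatteningRank t ≤ Fintype.card ι :=
  finrank_range_le_card _

/-- `ζ⁽¹⁾(⟨m,m,m⟩) = m²` (`m ≥ 1`). [cite: Blaser2013, Lemma 7.1 (2) (proof)] -/
theorem flatteningRank_matMulTensor_cube {m : ℕ} (hm : 0 < m) :
    flatteningRank (matMulTensor ℂ m m m) = m ^ 2 := by
  have h := flatteningRank_kronecker (unitTensor ℂ 1) (matMulTensor ℂ m m m)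
  rw [flatteningRank_multiple_matMulTensor 1 m m m hm, flatteningRank_unitTensor_one (K := ℂ),
    one_mul, one_mul] at h
  rw [sq]
  exact h.symm

/-- **Flattening**: `⟨m,m,m⟩ ≤ cw₂^{⊠N} ⟹ m² ≤ 3^N`. [folklore] -/
theorem sq_le_three_pow_of_mm {N m : ℕ}
    (h : TensorRestrictsTo (kroneckerPow (cwTensor ℂ 2) N) (matMulTensor ℂ m m m)) :
    m ^ 2 ≤ 3 ^ N := by
  rcases Nat.eq_zero_or_pos m with rfl | hm
  · simp
  have h1 : flatteningRank (matMulTensor ℂ m m m) ≤ flatteningRank (kroneckerPow (cwTensor ℂ 2) N) :=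
    flatteningRank_mono h
  rw [flatteningRank_kroneckerPow, flatteningRank_matMulTensor_cube hm] at h1
  have h2 : flatteningRank (cwTensor ℂ 2) ≤ 3 := by
    simpa using flatteningRank_le_card' (cwTensor ℂ 2)
  exact h1.trans (Nat.pow_le_pow_left h2 N)

end Restrictions

/-! ## Degenerations: padding, products, powers -/

section Degeneration

/-- **Padding a degeneration into a restriction.**  An order-`h` degeneration
`⟨m,m,m⟩ ⊴_h cw₂^{⊠N}` together with `L` further copies of `cw₂` with `2^L ≥ (h+1)²` is an honest
restriction `⟨m,m,m⟩ ≤ cw₂^{⊠(N+L)}`: `⟨m,m,m⟩ ≤ cw₂^{⊠N} ⊗ M_h` (BCS (15.26), tree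
`IsApproxRestriction.restrictsTo_kronecker_coeffTensor`), `M_h ≤ ⟨(h+1)²⟩ ≤ ⟨2^L⟩ ≤ cw₂^{⊠L}`.
[cite: BurgisserClausenShokrollahi1997, (15.26)] -/
theorem restrictsTo_pad_of_isApproxRestriction {N m h : ℕ}
    {A : (Fin m × Fin m) → (Fin N → Fin 3) → ℂ[X]} {B : (Fin m × Fin m) → (Fin N → Fin 3) → ℂ[X]}
    {C : (Fin m × Fin m) → (Fin N → Fin 3) → ℂ[X]}
    (hd : IsApproxRestriction h (kroneckerPow (cwTensor ℂ 2) N) (matMulTensor ℂ m m m) A B C)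
    {L : ℕ} (hL : (h + 1) ^ 2 ≤ 2 ^ L) :
    TensorRestrictsTo (kroneckerPow (cwTensor ℂ 2) (N + L)) (matMulTensor ℂ m m m) := by
  classical
  have h1 : TensorRestrictsTo (kroneckerTensor (kroneckerPow (cwTensor ℂ 2) N) (coeffTensor ℂ h))
      (matMulTensor ℂ m m m) :=
    IsApproxRestriction.restrictsTo_kronecker_coeffTensor (K := ℂ) hd
  have h2 : TensorRestrictsTo (unitTensor ℂ (2 ^ L)) (coeffTensor ℂ h) :=
    tensorRestrictsTo_unitTensor_of_tensorRank_le _ ((tensorRank_coeffTensor_le (K := ℂ) h).trans hL)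
  exact ((cwPow_add_restrictsTo N L).trans
    ((TensorRestrictsTo.refl _).kronecker ((cwPow_restrictsTo_unitTensor L).trans h2))).trans h1

/-- **Degeneration witnesses multiply, orders add**: `⟨m,m,m⟩ ⊴_h cw₂^{⊠N}` and
`⟨m',m',m'⟩ ⊴_{h'} cw₂^{⊠N'}` give `⟨mm',mm',mm'⟩ ⊴_{h+h'} cw₂^{⊠(N+N')}` (BCS (15.25) plus the two
relabellings). [cite: BurgisserClausenShokrollahi1997, (15.25)] -/
theorem deg_mul {N N' m m' h h' : ℕ}
    {A : (Fin m × Fin m) → (Fin N → Fin 3) → ℂ[X]} {B : (Fin m × Fin m) → (Fin N → Fin 3) → ℂ[X]}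
    {C : (Fin m × Fin m) → (Fin N → Fin 3) → ℂ[X]}
    {A' : (Fin m' × Fin m') → (Fin N' → Fin 3) → ℂ[X]} {B' : (Fin m' × Fin m') → (Fin N' → Fin 3) → ℂ[X]}
    {C' : (Fin m' × Fin m') → (Fin N' → Fin 3) → ℂ[X]}
    (hd : IsApproxRestriction h (kroneckerPow (cwTensor ℂ 2) N) (matMulTensor ℂ m m m) A B C)
    (hd' : IsApproxRestriction h' (kroneckerPow (cwTensor ℂ 2) N') (matMulTensor ℂ m' m' m') A' B' C') :
    ∃ (A'' : (Fin (m * m') × Fin (m * m')) → (Fin (N + N') → Fin 3) → ℂ[X])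
      (B'' : (Fin (m * m') × Fin (m * m')) → (Fin (N + N') → Fin 3) → ℂ[X])
      (C'' : (Fin (m * m') × Fin (m * m')) → (Fin (N + N') → Fin 3) → ℂ[X]),
      IsApproxRestriction (h + h') (kroneckerPow (cwTensor ℂ 2) (N + N'))
        (matMulTensor ℂ (m * m') (m * m') (m * m')) A'' B'' C'' := by
  obtain ⟨A₀, B₀, C₀, hs⟩ := cwPow_add_restrictsTo N N'
  -- `⟨m,m,m⟩ ⊗ ⟨m',m',m'⟩ ≥ ⟨mm',mm',mm'⟩` (double-index relabelling) [cite: Blaser2013, §5.2 p. 24] — a local copy: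
  -- the identical lemma is LANDED as `Theorems.OutsiderSandwichPackingProfile.matMul_kronecker_matMul_restrictsTo`
  -- (gate dedup.landed), whose module imports the route file and is therefore not imported into this route-free helper.
  have kronecker_matMul_restrictsTo : ∀ m m' : ℕ,
      TensorRestrictsTo (kroneckerTensor (matMulTensor ℂ m m m) (matMulTensor ℂ m' m' m'))
        (matMulTensor ℂ (m * m') (m * m') (m * m')) := by
    intro m m'
    have e : kroneckerTensor (matMulTensor ℂ m m m) (matMulTensor ℂ m' m' m') = fun a b c =>
        matMulTensor ℂ (m * m') (m * m') (m * m') (doubleIndexEquiv m m m' m' a)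
          (doubleIndexEquiv m m m' m' b) (doubleIndexEquiv m m m' m' c) := by
      funext a b c
      exact kroneckerTensor_matMulTensor (K := ℂ) m m m m' m' m' a b c
    rw [e]
    exact tensorRestrictsTo_of_reindex (matMulTensor ℂ _ _ _) _ _ _
  obtain ⟨A₁, B₁, C₁, ht⟩ := kronecker_matMul_restrictsTo m m'
  exact ⟨_, _, _, (IsApproxRestriction.comp_eq_sum hs (hd.kronecker hd')).eq_sum_comp ht⟩

/-- Powers of one degeneration witness: `⟨m,m,m⟩ ⊴_h cw₂^{⊠N} ⟹ ⟨m^{k+1}⟩³ ⊴_{h(k+1)} cw₂^{⊠N(k+1)}`.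
[cite: BurgisserClausenShokrollahi1997, (15.25)] -/
theorem deg_pow {N m h : ℕ}
    {A : (Fin m × Fin m) → (Fin N → Fin 3) → ℂ[X]} {B : (Fin m × Fin m) → (Fin N → Fin 3) → ℂ[X]}
    {C : (Fin m × Fin m) → (Fin N → Fin 3) → ℂ[X]}
    (hd : IsApproxRestriction h (kroneckerPow (cwTensor ℂ 2) N) (matMulTensor ℂ m m m) A B C)
    (k : ℕ) :
    ∃ (A' : (Fin (m ^ (k + 1)) × Fin (m ^ (k + 1))) → (Fin (N * (k + 1)) → Fin 3) → ℂ[X])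
      (B' : (Fin (m ^ (k + 1)) × Fin (m ^ (k + 1))) → (Fin (N * (k + 1)) → Fin 3) → ℂ[X])
      (C' : (Fin (m ^ (k + 1)) × Fin (m ^ (k + 1))) → (Fin (N * (k + 1)) → Fin 3) → ℂ[X]),
      IsApproxRestriction (h * (k + 1)) (kroneckerPow (cwTensor ℂ 2) (N * (k + 1)))
        (matMulTensor ℂ (m ^ (k + 1)) (m ^ (k + 1)) (m ^ (k + 1))) A' B' C' := by
  induction k with
  | zero =>
      rw [Nat.zero_add, Nat.mul_one N, Nat.mul_one h, pow_one]
      exact ⟨A, B, C, hd⟩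
  | succ k ih =>
      have e1 : N * (k + 1 + 1) = N * (k + 1) + N := by ring
      have e2 : h * (k + 1 + 1) = h * (k + 1) + h := by ring
      rw [e1, e2, pow_succ]
      obtain ⟨A', B', C', hk⟩ := ih
      exact deg_mul hk hd

/-- **Powers first, padding once**: `⟨m,m,m⟩ ⊴_h cw₂^{⊠N}` gives the honest restriction
`⟨m^{k+1}⟩³ ≤ cw₂^{⊠(N(k+1)+L)}` as soon as `2^L ≥ (h(k+1)+1)²` — the padding is `O(log k)` copies.
[cite: BurgisserClausenShokrollahi1997, (15.26)] -/
theorem restrictsTo_pow_pad_of_isApproxRestriction {N m h : ℕ}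
    {A : (Fin m × Fin m) → (Fin N → Fin 3) → ℂ[X]} {B : (Fin m × Fin m) → (Fin N → Fin 3) → ℂ[X]}
    {C : (Fin m × Fin m) → (Fin N → Fin 3) → ℂ[X]}
    (hd : IsApproxRestriction h (kroneckerPow (cwTensor ℂ 2) N) (matMulTensor ℂ m m m) A B C)
    (k L : ℕ) (hL : (h * (k + 1) + 1) ^ 2 ≤ 2 ^ L) :
    TensorRestrictsTo (kroneckerPow (cwTensor ℂ 2) (N * (k + 1) + L))
      (matMulTensor ℂ (m ^ (k + 1)) (m ^ (k + 1)) (m ^ (k + 1))) := by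
  obtain ⟨A', B', C', hk⟩ := deg_pow hd k
  exact restrictsTo_pad_of_isApproxRestriction hk hL

end Degeneration

end Summit.MatrixMultiplication.MatrixMultiplication.Theorems.OutsiderSandwichDegenerationWitness
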